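import Summits.BirchSwinnertonDyer.BirchSwinnertonDyer.Theorems.PrintCFramBottomClassIndexLawFiveLeKrizLiBindersAnchorBase
import Summits.BirchSwinnertonDyer.BirchSwinnertonDyer.Theorems.PrintCFramBottomClassIndexLawFiveLeKrizLiLocusKolyvagin
import Summits.BirchSwinnertonDyer.BirchSwinnertonDyer.Theorems.PrintCFramBottomClassIndexLawFiveLeEisensteinTraceFormClass
import Literature.NumberTheory.EllipticCurves.IsogenyIdProofs
import Mathlib.Tactic.NormNum.LegendreSymbol
import HarnessLib

/-!
# Crux `PrintCFram.BottomClassIndexLawFiveLe` (stmt-BirchSwinnertonDyer-20372), line `eisenstein-resource-bdp-line`: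
# THE ANCHOR `(A(19), p = 19, K'' = ℚ(√−31))` — two Bernoulli-unit certificates (`‖B_{1,ω^{13}}‖_{19} = 1`,
# `‖B_{1,χ_{−31}ω^{4}}‖_{19} = 1`, tables checked by the kernel) and hence the Kriz–Li CHARACTER ∧ `ε_K` ∧ BERNOULLI-(4) block and
# the END STATE «prints ∧ KL ∧ Heegner data over ℚ(√−31) ∧ UPPER ⟹ C2's conclusion» for every globally minimal rank-one `W ∼ A(19)`
# (cell `bsd-print-cfram`, width seat `bsd-line-cfram-p1-w3` g2; THEOREMS ONLY, `--supports` 20372; BSD is not proved by any of this)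

HONEST FRAMING. Nothing here proves BSD or closes a stub. `A(19)` (`cm19`, `j = -884736`) is the base curve of the leaf class at
`p = 19`; it has analytic rank one (`19 ≡ 3 (mod 8)`, Gross). Its Eisenstein pair is `(ω^{5}, ω^{14})` (w2 g2's `lFunction_cm19_mod`), so
`ψ = ω^{5}` is the ODD member, `ψ⁻¹ = ω^{13}` (class factor) and `ψε_Kω⁻¹ = χ_{−31}ω^{4}` (`K''`-factor) for the Heegner field
`ℚ(√−31)` (`19` splits there; `31` is the least admissible prime with both Bernoulli numbers `19`-adic units — local search, seconds).
Certificates follow w2's `AnchorBernoulli163(Twin)` template (`decide +kernel` on tables of `j^{p·a} mod p²`); the block and the END STATE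
follow `…KrizLiBindersAnchorBase` / `…Anchor163EndState`. What remains at this anchor: Heegner data `(Dt, H, P)` over `K''`,
`L(A(19)^{(−31)}, 1) ≠ 0`, and the Kolyvagin UPPER half (resp. regularity). beyond-print theorem: NO.
References: [KrizLi2019] Thm. 1.20, Rem. 1.21; [Washington1997] §5.1, Thm. 4.2; [Gross1980] §22; [Rubin1983] Thm. C.
-/

noncomputable section

-- summit-side namespace `Summit.BirchSwinnertonDyer.BirchSwinnertonDyer.…` (single-conjunct summit, D-0017 layout)
set_option linter.dupNamespace false

open scoped Classical NumberTheorySymbols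

namespace Summit.BirchSwinnertonDyer.BirchSwinnertonDyer.Theorems.PrintCFram.KrizLiBinders

open WeierstrassCurve NumberField IsDedekindDomain Field PowerSeries DirichletCharacter
  Literature.NumberTheory.EllipticCurves Literature.NumberTheory.EllipticCurves.GreenbergSelmer
  Literature.NumberTheory.EllipticCurves.GreenbergVatsal2000
  Literature.NumberTheory.EllipticCurves.ModularForms
  Literature.NumberTheory.EllipticCurves.KrizLi2019 Literature.NumberTheory.LFunctions
  Literature.NumberTheory.GaloisCohomology
  Literature.NumberTheory.EllipticCurves.Rank1Residual
  Literature.NumberTheory.EllipticCurves.Rank1Residual.Typed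
  Literature.NumberTheory.GaloisRepresentations
  Summit.BirchSwinnertonDyer.Rank1Residual
  Summit.BirchSwinnertonDyer.Rank1Residual.Additive
  Summit.BirchSwinnertonDyer.Rank1Residual.X11b Summit.BirchSwinnertonDyer.Rank1Residual.X11b.AcSelmer
  Summit.BirchSwinnertonDyer.Rank1Residual.X11b.Halves
  Summit.BirchSwinnertonDyer.Rank1Residual.X12 Summit.BirchSwinnertonDyer.Rank1Residual.X12.O11
  Summit.BirchSwinnertonDyer.Rank1Residual.X2.ResidualDevissageModules
  Summit.BirchSwinnertonDyer.BirchSwinnertonDyer.Theses.UniversalToricDescent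
  Summit.BirchSwinnertonDyer.BirchSwinnertonDyer.Theorems
  Summit.BirchSwinnertonDyer.BirchSwinnertonDyer.Theorems.SchneiderFree

/-- `31` is prime (global instance: `legendreSym 31` in the certificate statements below needs `Fact (Nat.Prime 31)`; cell `bsd-cm`'s
`RouteUPsiD11` registers the primes `7, 11, 19` the same way). [folklore] -/
instance fact_prime_31_krizLiAnchor : Fact (Nat.Prime 31) := ⟨by norm_num⟩

/-! ## §1 The class factor `‖B_{1,ω^{13}}‖_{19} = 1` -/

/-- The table `t(j) = j^{19·13} mod 19²`, `0 < j < 19`, checked by the kernel. [folklore] -/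
theorem teichmullerPowTable_19_13 : ∀ j, j < 19 → j ≠ 0 →
    j ^ (19 * 13) ≡ ((
    [0, 1, 307, 299, 28, 245, 99, 292, 293, 234, 127, 68, 69, 262, 116, 333, 62, 54, 360] : List ℕ).getD j 0) [MOD 19 ^ 2] := by
  decide +kernel

/-- The certificate sum `S = Σ t(j)·j = 31198` has `19 ∣ S`, `19² ∤ S`, checked by the kernel. [folklore] -/
theorem certSum_19_13 :
    ((19 : ℕ) : ℤ) ∣ ∑ j : ZMod 19, (((
    [0, 1, 307, 299, 28, 245, 99, 292, 293, 234, 127, 68, 69, 262, 116, 333, 62, 54, 360] : List ℕ).getD j.val 0 : ℕ) : ℤ) * (j.val : ℤ) ^ (0 + 1) ∧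
    ¬ ((19 : ℕ) : ℤ) ^ 2 ∣ ∑ j : ZMod 19, (((
    [0, 1, 307, 299, 28, 245, 99, 292, 293, 234, 127, 68, 69, 262, 116, 333, 62, 54, 360] : List ℕ).getD j.val 0 : ℕ) : ℤ) * (j.val : ℤ) ^ (0 + 1) := by
  constructor
  · decide +kernel
  · decide +kernel

/-- **`‖B_{1,ω^{13}}‖_{19} = 1`** for every Teichmüller character `ω` mod `19` (equivalently `19 ∤ B_{14}`): the class factor of
Kriz–Li's (4) at `A(19)` (`ψ⁻¹ = ω^{13}`). [cite: Washington1997, §5.1 and Thm. 4.2] [cite: KrizLi2019, Thm. 1.20 (p. 8)] -/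
theorem norm_bernoulliOnePrim_teichmuller_pow_13_p19 [Fact (Nat.Prime 19)]
    (ω : DirichletCharacter ℚ_[19] 19) (hω : IsTeichmullerCharacter ω) :
    ‖bernoulliOnePrim (ω ^ 13)‖ = 1 :=
  AnchorReduction.norm_bernoulliOnePrim_teichmuller_pow_of_table ω hω (by norm_num)
    (teichmuller_pow_ne_one hω (by norm_num) (by norm_num)) (fun j => (
    [0, 1, 307, 299, 28, 245, 99, 292, 293, 234, 127, 68, 69, 262, 116, 333, 62, 54, 360] : List ℕ).getD j 0) rfl teichmullerPowTable_19_13 certSum_19_13.1 certSum_19_13.2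

/-! ## §2 The `K''`-factor `‖B_{1,χ_{−31}·ω^{4}}‖_{19} = 1` -/

/-- The table `t(j) = j^{19·4} mod 19²`, `0 < j < 19`, checked by the kernel. [folklore] -/
theorem teichmullerPowTable_19_4 : ∀ j, j < 19 → j ≠ 0 →
    j ^ (19 * 4) ≡ ((
    [0, 1, 54, 62, 28, 245, 99, 292, 68, 234, 234, 68, 292, 99, 245, 28, 62, 54, 1] : List ℕ).getD j 0) [MOD 19 ^ 2] := by
  decide +kernel

/-- `ord_{19}(19·31) = 1`. [folklore] -/
theorem padicValNat_19_mul_31 : padicValNat 19 (19 * 31) = 1 := by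
  haveI : Fact (Nat.Prime 19) := ⟨by norm_num⟩
  rw [padicValNat.mul (by norm_num) (by norm_num), padicValNat_self, padicValNat.eq_zero_of_not_dvd (by norm_num)]

/-- The certificate sum `S = Σ_{j mod 589} (j/31)·t(j mod 19)·j = -1188602` has `19 ∣ S`, `19² ∤ S`, checked by the kernel. [folklore] -/
theorem certSum_19_4_31 :
    ((19 : ℕ) : ℤ) ∣ ∑ j : ZMod (19 * 31), (legendreSym 31 (j.val : ℤ) * (((
    [0, 1, 54, 62, 28, 245, 99, 292, 68, 234, 234, 68, 292, 99, 245, 28, 62, 54, 1] : List ℕ).getD (j.val % 19) 0 : ℕ) : ℤ)) * (j.val : ℤ) ^ (0 + 1) ∧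
    ¬ ((19 : ℕ) : ℤ) ^ 2 ∣ ∑ j : ZMod (19 * 31), (legendreSym 31 (j.val : ℤ) * (((
    [0, 1, 54, 62, 28, 245, 99, 292, 68, 234, 234, 68, 292, 99, 245, 28, 62, 54, 1] : List ℕ).getD (j.val % 19) 0 : ℕ) : ℤ)) * (j.val : ℤ) ^ (0 + 1) := by
  constructor
  · decide +kernel
  · decide +kernel

set_option maxRecDepth 40000 in
/-- **`‖B_{1,χ_{−31}·ω^{4}}‖_{19} = 1`**: for every Teichmüller `ω` mod `19` and every `ℚ_19`-valued `θ` mod `589 = 19·31` with values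
`θ(j) = (j/31)·ω(j)^{4}`, `B_{1,θ}` is a `19`-adic unit — the `K''`-factor of Kriz–Li's (4) at `(A(19), ℚ(√−31))` (`ψε_Kω⁻¹ = χ_{−31}ω^{4}`,
`4 = (19−3)/4`). `θ ≠ 1` by `θ(58) = (27/31)·ω(1)^{4} = −1`. [cite: KrizLi2019, Thm. 1.20 (p. 8)] [cite: Rubin1983, §0 Thm. C] [cite: Washington1997, Thm. 4.2] -/
theorem norm_generalizedBernoulli_theta2_A19 [Fact (Nat.Prime 19)]
    (ω : DirichletCharacter ℚ_[19] 19) (hω : IsTeichmullerCharacter ω) (θ : DirichletCharacter ℚ_[19] (19 * 31))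
    (hθ : ∀ j : ZMod (19 * 31), θ j = (legendreSym 31 (j.val : ℤ) : ℚ_[19]) * ω (j.val : ZMod 19) ^ 4) :
    ‖generalizedBernoulli 1 θ‖ = 1 := by
  have hθ1 : θ ≠ 1 := by
    intro h
    have hA := hθ ((58 : ℕ) : ZMod (19 * 31))
    have hv : (((58 : ℕ) : ZMod (19 * 31))).val = 58 := by
      rw [ZMod.val_natCast]
    have hu : IsUnit (((58 : ℕ) : ZMod (19 * 31))) :=
      (ZMod.isUnit_iff_coprime 58 (19 * 31)).mpr (by norm_num)
    have h1 : ((58 : ℕ) : ZMod 19) = 1 := by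
      rw [show (58 : ℕ) = 19 * 3 + 1 from rfl, Nat.cast_add, Nat.cast_mul, ZMod.natCast_self, zero_mul, zero_add,
        Nat.cast_one]
    have hleg : legendreSym 31 ((58 : ℕ) : ℤ) = -1 := by
      rw [legendreSym.mod]; norm_num
    rw [h, MulChar.one_apply hu, hv, h1, map_one, one_pow, mul_one, hleg] at hA
    norm_num at hA
  exact AnchorReduction.norm_generalizedBernoulli_legendre_teichmullerPow_of_cert ω hω (by norm_num) padicValNat_19_mul_31 θ hθ1 hθ
    (fun j => (
    [0, 1, 54, 62, 28, 245, 99, 292, 68, 234, 234, 68, 292, 99, 245, 28, 62, 54, 1] : List ℕ).getD j 0) rfl teichmullerPowTable_19_4 certSum_19_4_31.1 certSum_19_4_31.2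

/-! ## §3 The block and the END STATE at `(A(19), 19, ℚ(√−31))` -/

/-- **The Kriz–Li character ∧ `ε_K` ∧ Bernoulli block at `(A(19), 19, K'')` for every quadratic field `K''` of discriminant `−31`**:
for every `W ∼ A(19)`: `∃ f ψ ω εK`, `ψ.IsPrimitive ∧ IsTeichmullerCharacter ω ∧ hss ∧ (1) ∧ (3) ∧ IsKroneckerCharacterOf K'' εK ∧ (4) ∧ ψ.Odd`
(`ψ = ω^{5}`). [cite: KrizLi2019, Thm. 1.20 (pp. 7–8), Rem. 1.21, §2 (p. 12)] [cite: Mazur1978, Prop. 6.3 (1) (p. 153)] -/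
theorem exists_krizLiCharacterBlock_A19 [Fact (Nat.Prime 19)] (W : WeierstrassCurve ℚ) [W.IsElliptic]
    (hiso : IsIsogenous W cm19) (K : Type) [Field K] [NumberField K] (hK2 : Module.finrank ℚ K = 2)
    (hdK : NumberField.discr K = -31) [NeZero (NumberField.discr K).natAbs] :
    ∃ (f : ℕ) (_ : NeZero f) (ψ : DirichletCharacter ℚ_[19] f) (ω : DirichletCharacter ℚ_[19] 19)
      (εK : DirichletCharacter ℚ_[19] (NumberField.discr K).natAbs),
      ψ.IsPrimitive ∧ IsTeichmullerCharacter ω ∧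
      (∀ ℓ : ℕ, ℓ.Prime → ¬ (ℓ ∣ 19 * W.conductorNorm ℤ) →
        ‖((W.LFunction ℓ : ℤ) : ℚ_[19]) - (ψ (ℓ : ZMod f) + ψ⁻¹ (ℓ : ZMod f) * ω (ℓ : ZMod 19))‖ < 1) ∧
      (ψ ((19 : ℕ) : ZMod f) ≠ 1 ∧ primVal (invMulOmega ψ ω) 19 ≠ 1) ∧
      (∀ ℓ : ℕ, (hℓ : ℓ.Prime) → ℓ ≠ 19 →
        (haveI := Fact.mk hℓ; ¬ W.HasGoodReductionAtPrime ℓ ∧ ¬ W.HasMultiplicativeReductionAtPrime ℓ) →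
        ψ (ℓ : ZMod f) ≠ 1 ∧ primVal (invMulOmega ψ ω) ℓ ≠ 1) ∧
      IsKroneckerCharacterOf K εK ∧
      ¬ (‖bernoulliOnePrim (bernoulliCharOne ψ εK) * bernoulliOnePrim (bernoulliCharTwo ψ εK ω)‖ ≤ ((19 : ℕ) : ℝ)⁻¹) ∧
      ψ.Odd := by
  exact exists_krizLiCharacterBlock_base (p := 19) (by norm_num) cm19 (k := 5) (by norm_num) (by norm_num) (by decide)
    (fun r _ h => EisensteinTraceForm.hasGoodReductionAtPrime_cm19 r h) (fun ℓ _ h => by simpa using EisensteinTraceForm.lFunction_cm19_mod ℓ h) W hiso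
    (q := 31) (by norm_num) (by norm_num) K hK2 (by rw [hdK]; norm_num)
    (fun ω hω => norm_bernoulliOnePrim_teichmuller_pow_13_p19 ω hω)
    (fun ω hω θ hθ => norm_generalizedBernoulli_theta2_A19 ω hω θ hθ)

/-- **Heegner hypothesis for `(N_W, K'')` at the anchor `A(19)`**: the only bad prime of `W ∼ A(19)` is `19`, which splits in every quadratic
field of discriminant `−31` (`(−31/19) = +1`). [cite: GrossLMS1991, §1 (p. 235)] [cite: Cox2013, §1.C (1.18)] -/
theorem satisfiesHeegnerHypothesis_A19 [Fact (Nat.Prime 19)] (W : WeierstrassCurve ℚ) [W.IsElliptic]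
    (hiso : IsIsogenous W cm19) (K : Type) [Field K] [NumberField K] (hK2 : Module.finrank ℚ K = 2)
    (hdK : NumberField.discr K = -31) :
    SatisfiesHeegnerHypothesis (W.conductorNorm ℤ) K := by
  intro ℓ hℓ hℓN
  haveI := Fact.mk hℓ
  have hℓp : ℓ = 19 := by
    by_contra hne
    exact not_dvd_conductorNorm_of_hasGoodReductionAtPrime W
      ((hiso.hasGoodReductionAtPrime_iff ℓ).mpr (EisensteinTraceForm.hasGoodReductionAtPrime_cm19 ℓ hne)) hℓN
  subst hℓp
  rw [Literature.NumberTheory.QuadraticFields.Quadratic.ncard_primesOver_eq_two_iff_legendreSym hK2 (by norm_num), hdK]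
  norm_num

/-- **END STATE at the anchor `A(19)`, Kolyvagin form** (LEAD g6's Kriz–Li-datum theorem with the twelve character-side hypotheses
discharged and the Heegner hypothesis automatic): for every globally minimal rank-one `W ∼ A(19)` (CM, `19` CM-ramified), every imaginary
quadratic `K''` with `d_{K''} = −31`, Heegner data `(Dt, H, ι, P)` at level `N_W` with `L(W^{(−31)},1) ≠ 0`, and the finite-level Kolyvagin
UPPER inequality at that datum: `RamifiedCMBottomClassIndexLawAtZp W 19` — conditional on the seven citations and Kriz–Li Thm. 1.20 only.
[cite: KrizLi2019, Thm. 1.20 (pp. 7–8), Rem. 1.21 (p. 8)] [cite: GrigorovJorzaPatrikisSteinTarnita2009, Thm. 3.7] -/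
theorem ramifiedCMBottomClassIndexLawAtZp_A19_of_indexUpper [Fact (Nat.Prime 19)]
    (hprints : Hsieh2014.thmA_exists_isHsiehLFunction_unrPeriod_anyLevel ∧
      LiuZhangZhang2018.thm151_thm153_modularCurve_heegnerVector_additive ∧
      ToricPublishedInputs ∧
      (∀ (K : Type) [Field K] [NumberField K], poitouTate_sha_tateDual K) ∧
      bsdTriple_of_hasCM_of_L_one_ne_zero ∧ hasEntireLFunction_rat ∧ bsdRHS_eq_of_isIsogenous)
    (hKL : KrizLi2019.thm120_padicLogHeegner_unit_of_bernoulli)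
    (W : WeierstrassCurve ℚ) [W.IsElliptic] [W.IsGloballyMinimal] (hCM : W.HasCM) (hram : CMRamified W 19)
    (hiso : IsIsogenous W cm19) (hr : W.analyticRank = 1) [NeZero (W.conductorNorm ℤ)]
    (K : Type) [Field K] [NumberField K] [NeZero (NumberField.discr K).natAbs]
    (Dt : ModularParametrizationData W (W.conductorNorm ℤ)) (H : HeegnerDatum (W.conductorNorm ℤ) (NumberField.discr K))
    (ι : K →+* ℂ) (P : (W.baseChange K).toAffine.Point)
    (hK : IsImaginaryQuadratic K) (hdK : NumberField.discr K = -31)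
    (hLt : (W.quadraticTwist (NumberField.discr K : ℚ)).entireLFunction 1 ≠ 0)
    (hP : WeierstrassCurve.Affine.Point.map ι.toRatAlgHom P = heegnerPointComplex Dt H)
    (hup : ¬ IsOfFinAddOrder P → Upper.IndexUpperBoundLeAt W 19 K P (padicValNat 19 Dt.c.natAbs)) :
    X12.O11.RamifiedCMBottomClassIndexLawAtZp W 19 := by
  obtain ⟨f, hf, ψ, ω, εK, hψ, hω, hss, ⟨h1, h1'⟩, h3, hεK, h4, -⟩ :=
    exists_krizLiCharacterBlock_A19 W hiso K hK.1 hdK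
  haveI := hf
  have hodd : Odd (NumberField.discr K) := by rw [hdK]; decide
  have hd4 : NumberField.discr K < -4 := by rw [hdK]; norm_num
  exact KrizLiKolyvagin.ramifiedCMBottomClassIndexLawAtZp_of_krizLiDatum_of_indexUpper hprints hKL W hCM hram (by norm_num) hr
    (W.conductorNorm ℤ) K Dt H ι P rfl hK (satisfiesHeegnerHypothesis_A19 W hiso K hK.1 hdK) hodd hd4 hLt hP f ψ ω hψ hω hss
    h1 h1' h3 εK hεK h4 hup

end Summit.BirchSwinnertonDyer.BirchSwinnertonDyer.Theorems.PrintCFram.KrizLiBinders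

end
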